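import Mathlib
import Summits.Ventures.HodgeRepro2.T5CompletionFundamentalIdentity
import Summits.Ventures.HodgeRepro2.T5CompletionDegreeOfUnique
import Summits.Ventures.HodgeRepro2.T5CompletionDegreeOne

/-!
# THE ALL-PLACES SUM `∑_{w ∣ v} [L_w : K_v] = [L : K]` (T5CompletionDegreeSum)

Mathlib's fundamental identity `∑_{P ∣ v} e(P∣v) · f(P∣v) = [L : K]` (`Ideal.sum_ramification_inertia`, a sum over
the finset of PRIME IDEALS `primesOverFinset v.asIdeal 𝓞_L`) is transported to the PLACES of `L` above `v` (elements
of `HeightOneSpectrum 𝓞_L`): for every finset `S` of places of `L` whose members are exactly the places above `v`,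
`∑_{w ∈ S} e(w∣v) · f(w∣v) = [L : K]` (`sum_ramificationIdx'_mul_inertiaDeg'`), hence, with
`[L_w : K_v] = e(w∣v) · f(w∣v)` (T5CompletionFundamentalIdentity), `∑_{w ∈ S} [L_w : K_v] = [L : K]`
(`sum_attach_finrank`; the `K_v`-algebra structure on `L_w` needs `w ∣ v`, so the completion reading is a sum over
`S.attach`). Such an `S` exists (`exists_finset_places_over`), it is non-empty (`nonempty`), and its cardinality is at
most `[L : K]` (`card_le_finrank`).

For a quadratic `L/K` this closes the global dictionary in the remaining direction: `[L_w : K_v] = [L : K]` FORCES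
`w` to be the only place above `v` (`unique_of_finrank_eq`, the converse of T5CompletionDegreeOfUnique;
`finrank_eq_two_iff_unique` is the biconditional); `[L_w : K_v] = 1` forces a SECOND place `w' ≠ w` above `v`, also of
local degree `1` (`exists_ne_of_finrank_eq_one` — the print's «`v` splits in `E`» = two places, both completions equal
to `K_v`); the number of places above `v` is `1` or `2`, it is `2` exactly when every local degree is `1`
(`card_eq_two_iff_finrank`), and `1` exactly when some place has local degree `2` (`card_eq_one_iff_finrank`).

No axiom beyond the standard trio; nothing of the scored record changes.
§8(d): uses an L-value-free non-vanishing device: NO.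
-/

namespace Summit.Ventures.HodgeRepro2.T5CompletionDegreeSum

open IsDedekindDomain HeightOneSpectrum NumberField

variable {K : Type*} [Field K] [NumberField K] (v : HeightOneSpectrum (NumberField.RingOfIntegers K))
  {L : Type*} [Field L] [NumberField L] [Algebra K L]

/-! ### Places above `v` and the primes over `v.asIdeal` -/

/-- The prime ideal of a place `w` above `v` is a prime of `𝓞_L` over `v.asIdeal`. -/
theorem asIdeal_mem_primesOverFinset (w : HeightOneSpectrum (NumberField.RingOfIntegers L))
    [w.asIdeal.LiesOver v.asIdeal] :
    w.asIdeal ∈ IsDedekindDomain.primesOverFinset v.asIdeal (NumberField.RingOfIntegers L) := by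
  rw [IsDedekindDomain.mem_primesOverFinset_iff v.ne_bot]
  exact ⟨w.isPrime, inferInstance⟩

/-- Every prime of `𝓞_L` over `v.asIdeal` is the ideal of a place of `L` above `v`. -/
theorem exists_place_of_mem_primesOverFinset {P : Ideal (NumberField.RingOfIntegers L)}
    (hP : P ∈ IsDedekindDomain.primesOverFinset v.asIdeal (NumberField.RingOfIntegers L)) :
    ∃ w : HeightOneSpectrum (NumberField.RingOfIntegers L), w.asIdeal = P ∧ w.asIdeal.LiesOver v.asIdeal := by
  rw [IsDedekindDomain.mem_primesOverFinset_iff v.ne_bot] at hP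
  exact ⟨⟨P, hP.1, Ideal.ne_bot_of_mem_primesOver v.ne_bot hP⟩, rfl, hP.2⟩

/-- THE FINITE SET OF PLACES ABOVE `v` EXISTS: a finset of places of `L` whose members are exactly the places
above `v`. -/
theorem exists_finset_places_over :
    ∃ S : Finset (HeightOneSpectrum (NumberField.RingOfIntegers L)),
      ∀ w : HeightOneSpectrum (NumberField.RingOfIntegers L), w ∈ S ↔ w.asIdeal.LiesOver v.asIdeal := by
  classical
  refine ⟨(IsDedekindDomain.primesOverFinset v.asIdeal (NumberField.RingOfIntegers L)).attach.image
    (fun P => ⟨P.1, ((IsDedekindDomain.mem_primesOverFinset_iff v.ne_bot _).1 P.2).1,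
      Ideal.ne_bot_of_mem_primesOver v.ne_bot ((IsDedekindDomain.mem_primesOverFinset_iff v.ne_bot _).1 P.2)⟩),
    fun w => ?_⟩
  rw [Finset.mem_image]
  constructor
  · rintro ⟨P, -, rfl⟩
    exact ((IsDedekindDomain.mem_primesOverFinset_iff v.ne_bot _).1 P.2).2
  · intro hw
    refine ⟨⟨w.asIdeal, asIdeal_mem_primesOverFinset v w⟩, Finset.mem_attach _ _, ?_⟩
    exact HeightOneSpectrum.ext rfl

/-- A finset of places that is exactly the set of places above `v` maps onto the primes over `v.asIdeal`. -/
theorem image_asIdeal_eq [DecidableEq (Ideal (NumberField.RingOfIntegers L))]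
    (S : Finset (HeightOneSpectrum (NumberField.RingOfIntegers L)))
    (hS : ∀ w : HeightOneSpectrum (NumberField.RingOfIntegers L), w ∈ S ↔ w.asIdeal.LiesOver v.asIdeal) :
    S.image HeightOneSpectrum.asIdeal =
      IsDedekindDomain.primesOverFinset v.asIdeal (NumberField.RingOfIntegers L) := by
  ext P
  rw [Finset.mem_image]
  constructor
  · rintro ⟨w, hw, rfl⟩
    haveI := (hS w).1 hw
    exact asIdeal_mem_primesOverFinset v w
  · intro hP
    obtain ⟨w, hwP, hw⟩ := exists_place_of_mem_primesOverFinset v hP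
    exact ⟨w, (hS w).2 hw, hwP⟩

/-! ### The all-places sum -/

/-- `e(w∣v) · f(w∣v) ≥ 1` at every place `w` above `v`. -/
theorem one_le_ramificationIdx'_mul_inertiaDeg' (w : HeightOneSpectrum (NumberField.RingOfIntegers L))
    [w.asIdeal.LiesOver v.asIdeal] :
    1 ≤ v.asIdeal.ramificationIdx' w.asIdeal * v.asIdeal.inertiaDeg' w.asIdeal := by
  haveI : v.asIdeal.IsMaximal := v.isMaximal
  refine Nat.one_le_iff_ne_zero.2 (mul_ne_zero ?_ ?_)
  · exact Ideal.IsDedekindDomain.ramificationIdx'_ne_zero_of_liesOver w.asIdeal v.ne_bot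
  · exact Summit.Ventures.HodgeRepro2.T5CompletionDegreeOne.inertiaDeg'_ne_zero v w

/-- THE ALL-PLACES SUM OVER PLACES: for a finset `S` of places of `L` that is exactly the set of places above `v`,
`∑_{w ∈ S} e(w∣v) · f(w∣v) = [L : K]` (Mathlib's `Ideal.sum_ramification_inertia` transported from prime ideals to
places). -/
theorem sum_ramificationIdx'_mul_inertiaDeg' (S : Finset (HeightOneSpectrum (NumberField.RingOfIntegers L)))
    (hS : ∀ w : HeightOneSpectrum (NumberField.RingOfIntegers L), w ∈ S ↔ w.asIdeal.LiesOver v.asIdeal) :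
    ∑ w ∈ S, v.asIdeal.ramificationIdx' w.asIdeal * v.asIdeal.inertiaDeg' w.asIdeal = Module.finrank K L := by
  haveI : v.asIdeal.IsMaximal := v.isMaximal
  rw [← Ideal.sum_ramification_inertia (NumberField.RingOfIntegers L) K L v.ne_bot]
  refine Finset.sum_nbij HeightOneSpectrum.asIdeal (fun w hw => ?_) (fun w₁ _ w₂ _ h => ?_) (fun P hP => ?_)
    (fun w _ => rfl)
  · haveI := (hS w).1 hw
    exact asIdeal_mem_primesOverFinset v w
  · exact HeightOneSpectrum.ext h
  · obtain ⟨w, hwP, hw⟩ := exists_place_of_mem_primesOverFinset v hP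
    exact ⟨w, (hS w).2 hw, hwP⟩

/-- THE ALL-PLACES SUM OF LOCAL DEGREES: `∑_{w ∣ v} [L_w : K_v] = [L : K]` (the sum runs over `S.attach` because the
`K_v`-algebra structure on `L_w` is only defined for `w ∣ v`). -/
theorem sum_attach_finrank (S : Finset (HeightOneSpectrum (NumberField.RingOfIntegers L)))
    (hS : ∀ w : HeightOneSpectrum (NumberField.RingOfIntegers L), w ∈ S ↔ w.asIdeal.LiesOver v.asIdeal) :
    ∑ w ∈ S.attach, (haveI : w.1.asIdeal.LiesOver v.asIdeal := (hS w.1).1 w.2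
      Module.finrank (v.adicCompletion K) (w.1.adicCompletion L)) = Module.finrank K L := by
  rw [← sum_ramificationIdx'_mul_inertiaDeg' v S hS, ← Finset.sum_attach S]
  refine Finset.sum_congr rfl fun w _ => ?_
  haveI : w.1.asIdeal.LiesOver v.asIdeal := (hS w.1).1 w.2
  exact Summit.Ventures.HodgeRepro2.T5CompletionFundamentalIdentity.finrank_eq_ramificationIdx'_mul_inertiaDeg' v w.1

/-- The number of places of `L` above `v` is at most `[L : K]`. -/
theorem card_le_finrank (S : Finset (HeightOneSpectrum (NumberField.RingOfIntegers L)))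
    (hS : ∀ w : HeightOneSpectrum (NumberField.RingOfIntegers L), w ∈ S ↔ w.asIdeal.LiesOver v.asIdeal) :
    S.card ≤ Module.finrank K L := by
  rw [← sum_ramificationIdx'_mul_inertiaDeg' v S hS, Finset.card_eq_sum_ones]
  refine Finset.sum_le_sum fun w hw => ?_
  haveI := (hS w).1 hw
  exact one_le_ramificationIdx'_mul_inertiaDeg' v w

/-- There is a place of `L` above `v`. -/
theorem nonempty (S : Finset (HeightOneSpectrum (NumberField.RingOfIntegers L)))
    (hS : ∀ w : HeightOneSpectrum (NumberField.RingOfIntegers L), w ∈ S ↔ w.asIdeal.LiesOver v.asIdeal) :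
    S.Nonempty := by
  rw [Finset.nonempty_iff_ne_empty]
  intro hS0
  have h := sum_ramificationIdx'_mul_inertiaDeg' v S hS
  rw [hS0, Finset.sum_empty] at h
  exact (Module.finrank_pos (R := K) (M := L)).ne h

/-- A place above `v` exists (no finset needed). -/
theorem exists_liesOver :
    ∃ w : HeightOneSpectrum (NumberField.RingOfIntegers L), w.asIdeal.LiesOver v.asIdeal := by
  obtain ⟨S, hS⟩ := exists_finset_places_over (L := L) v
  obtain ⟨w, hw⟩ := nonempty v S hS
  exact ⟨w, (hS w).1 hw⟩

/-! ### The converse of T5CompletionDegreeOfUnique: a full local degree forces a unique place -/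

/-- A SECOND place above `v` costs at least one: if `w' ≠ w` both lie above `v`, then `[L_w : K_v] + 1 ≤ [L : K]`. -/
theorem finrank_add_one_le_of_ne (w : HeightOneSpectrum (NumberField.RingOfIntegers L))
    [w.asIdeal.LiesOver v.asIdeal] (w' : HeightOneSpectrum (NumberField.RingOfIntegers L))
    (hw' : w'.asIdeal.LiesOver v.asIdeal) (hne : w' ≠ w) :
    Module.finrank (v.adicCompletion K) (w.adicCompletion L) + 1 ≤ Module.finrank K L := by
  classical
  obtain ⟨S, hS⟩ := exists_finset_places_over (L := L) v
  have hsum := sum_ramificationIdx'_mul_inertiaDeg' v S hS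
  have hwS : w ∈ S := (hS w).2 inferInstance
  have hw'S : w' ∈ S.erase w := Finset.mem_erase.2 ⟨hne, (hS w').2 hw'⟩
  rw [← Finset.add_sum_erase S _ hwS, ← Finset.add_sum_erase (S.erase w) _ hw'S] at hsum
  haveI := hw'
  have h1 := one_le_ramificationIdx'_mul_inertiaDeg' v w'
  have hw187 :=
    Summit.Ventures.HodgeRepro2.T5CompletionFundamentalIdentity.finrank_eq_ramificationIdx'_mul_inertiaDeg' v w
  omega

/-- `[L_w : K_v] = [L : K]` FORCES `w` to be the only place of `L` above `v` (the converse of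
`T5CompletionDegreeOfUnique.finrank_eq_of_unique`). -/
theorem unique_of_finrank_eq (w : HeightOneSpectrum (NumberField.RingOfIntegers L))
    [w.asIdeal.LiesOver v.asIdeal]
    (h : Module.finrank (v.adicCompletion K) (w.adicCompletion L) = Module.finrank K L)
    (w' : HeightOneSpectrum (NumberField.RingOfIntegers L)) (hw' : w'.asIdeal.LiesOver v.asIdeal) : w' = w := by
  by_contra hne
  have := finrank_add_one_le_of_ne v w w' hw' hne
  omega

/-- `[L_w : K_v] = [L : K] ↔ w is the only place above v` (T5CompletionDegreeOfUnique gives `←`). -/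
theorem finrank_eq_iff_unique (w : HeightOneSpectrum (NumberField.RingOfIntegers L))
    [w.asIdeal.LiesOver v.asIdeal] :
    Module.finrank (v.adicCompletion K) (w.adicCompletion L) = Module.finrank K L ↔
      ∀ w' : HeightOneSpectrum (NumberField.RingOfIntegers L), w'.asIdeal.LiesOver v.asIdeal → w' = w :=
  ⟨fun h w' hw' => unique_of_finrank_eq v w h w' hw',
    fun huniq => Summit.Ventures.HodgeRepro2.T5CompletionDegreeOfUnique.finrank_eq_of_unique v w huniq⟩

/-- For a quadratic `L/K`: `[L_w : K_v] = 2` forces `w` to be the only place above `v` (the `h2 ⟹ unique`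
direction; `T5CompletionDegreeOfUnique.finrank_eq_two_of_unique` is the converse). -/
theorem unique_of_finrank_eq_two (hKL : Module.finrank K L = 2)
    (w : HeightOneSpectrum (NumberField.RingOfIntegers L)) [w.asIdeal.LiesOver v.asIdeal]
    (h : Module.finrank (v.adicCompletion K) (w.adicCompletion L) = 2)
    (w' : HeightOneSpectrum (NumberField.RingOfIntegers L)) (hw' : w'.asIdeal.LiesOver v.asIdeal) : w' = w :=
  unique_of_finrank_eq v w (by rw [h, hKL]) w' hw'

/-- THE QUADRATIC DICTIONARY, BOTH WAYS: for a quadratic `L/K` and a place `w` above `v`,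
`[L_w : K_v] = 2 ↔ w is the only place above v`. -/
theorem finrank_eq_two_iff_unique (hKL : Module.finrank K L = 2)
    (w : HeightOneSpectrum (NumberField.RingOfIntegers L)) [w.asIdeal.LiesOver v.asIdeal] :
    Module.finrank (v.adicCompletion K) (w.adicCompletion L) = 2 ↔
      ∀ w' : HeightOneSpectrum (NumberField.RingOfIntegers L), w'.asIdeal.LiesOver v.asIdeal → w' = w := by
  rw [← hKL]
  exact finrank_eq_iff_unique v w

/-! ### The split case of a quadratic extension: two places, both of local degree `1` -/

/-- For a quadratic `L/K`: `[L_w : K_v] = 1` forces a SECOND place `w' ≠ w` above `v`, also with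
`[L_{w'} : K_v] = 1` — «`v` splits in `L`». -/
theorem exists_ne_of_finrank_eq_one (hKL : Module.finrank K L = 2)
    (w : HeightOneSpectrum (NumberField.RingOfIntegers L)) [w.asIdeal.LiesOver v.asIdeal]
    (h : Module.finrank (v.adicCompletion K) (w.adicCompletion L) = 1) :
    ∃ (w' : HeightOneSpectrum (NumberField.RingOfIntegers L)) (_ : w'.asIdeal.LiesOver v.asIdeal),
      w' ≠ w ∧ Module.finrank (v.adicCompletion K) (w'.adicCompletion L) = 1 := by
  classical
  obtain ⟨S, hS⟩ := exists_finset_places_over (L := L) v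
  have hsum := sum_ramificationIdx'_mul_inertiaDeg' v S hS
  have hwS : w ∈ S := (hS w).2 inferInstance
  have hw187 :=
    Summit.Ventures.HodgeRepro2.T5CompletionFundamentalIdentity.finrank_eq_ramificationIdx'_mul_inertiaDeg' v w
  rw [← Finset.add_sum_erase S _ hwS, ← hw187, h, hKL] at hsum
  -- the remaining sum is `1`, so the erased finset is non-empty
  have hne : (S.erase w).Nonempty := by
    rw [Finset.nonempty_iff_ne_empty]
    intro h0
    rw [h0, Finset.sum_empty] at hsum
    omega
  obtain ⟨w', hw'⟩ := hne
  have hw'v : w'.asIdeal.LiesOver v.asIdeal := (hS w').1 (Finset.mem_of_mem_erase hw')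
  haveI := hw'v
  refine ⟨w', hw'v, (Finset.mem_erase.1 hw').1, ?_⟩
  rw [← Finset.add_sum_erase (S.erase w) _ hw'] at hsum
  have h1 := one_le_ramificationIdx'_mul_inertiaDeg' v w'
  rw [Summit.Ventures.HodgeRepro2.T5CompletionFundamentalIdentity.finrank_eq_ramificationIdx'_mul_inertiaDeg' v w']
  omega

/-- For a quadratic `L/K`: the number of places above `v` is `1` or `2`. -/
theorem card_eq_one_or_two (hKL : Module.finrank K L = 2)
    (S : Finset (HeightOneSpectrum (NumberField.RingOfIntegers L)))
    (hS : ∀ w : HeightOneSpectrum (NumberField.RingOfIntegers L), w ∈ S ↔ w.asIdeal.LiesOver v.asIdeal) :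
    S.card = 1 ∨ S.card = 2 := by
  have h1 : S.card ≤ Module.finrank K L := card_le_finrank v S hS
  have h2 : 0 < S.card := (nonempty v S hS).card_pos
  rw [hKL] at h1
  omega

/-- For a quadratic `L/K`: there are TWO places above `v` exactly when `e(w∣v) · f(w∣v) = 1` at every place above
`v`. -/
theorem card_eq_two_iff (hKL : Module.finrank K L = 2)
    (S : Finset (HeightOneSpectrum (NumberField.RingOfIntegers L)))
    (hS : ∀ w : HeightOneSpectrum (NumberField.RingOfIntegers L), w ∈ S ↔ w.asIdeal.LiesOver v.asIdeal) :
    S.card = 2 ↔ ∀ w ∈ S, v.asIdeal.ramificationIdx' w.asIdeal * v.asIdeal.inertiaDeg' w.asIdeal = 1 := by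
  classical
  have hsum := sum_ramificationIdx'_mul_inertiaDeg' v S hS
  rw [hKL] at hsum
  constructor
  · intro hcard w hw
    -- each term is `≥ 1` and there are two terms summing to `2`, so each term is `1`
    by_contra hne
    haveI := (hS w).1 hw
    have h2 : 2 ≤ v.asIdeal.ramificationIdx' w.asIdeal * v.asIdeal.inertiaDeg' w.asIdeal := by
      have := one_le_ramificationIdx'_mul_inertiaDeg' v w
      omega
    have hrest : (S.erase w).card ≤
        ∑ x ∈ S.erase w, v.asIdeal.ramificationIdx' x.asIdeal * v.asIdeal.inertiaDeg' x.asIdeal := by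
      rw [Finset.card_eq_sum_ones]
      refine Finset.sum_le_sum fun x hx => ?_
      haveI := (hS x).1 (Finset.mem_of_mem_erase hx)
      exact one_le_ramificationIdx'_mul_inertiaDeg' v x
    rw [Finset.card_erase_of_mem hw, hcard] at hrest
    rw [← Finset.add_sum_erase S _ hw] at hsum
    omega
  · intro hall
    rw [Finset.sum_congr rfl hall, Finset.sum_const, smul_eq_mul, mul_one] at hsum
    exact hsum

/-- For a quadratic `L/K`: there are TWO places above `v` exactly when `[L_w : K_v] = 1` at every place `w`
above `v`. -/
theorem card_eq_two_iff_finrank (hKL : Module.finrank K L = 2)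
    (S : Finset (HeightOneSpectrum (NumberField.RingOfIntegers L)))
    (hS : ∀ w : HeightOneSpectrum (NumberField.RingOfIntegers L), w ∈ S ↔ w.asIdeal.LiesOver v.asIdeal) :
    S.card = 2 ↔ ∀ (w : HeightOneSpectrum (NumberField.RingOfIntegers L)) [w.asIdeal.LiesOver v.asIdeal],
      Module.finrank (v.adicCompletion K) (w.adicCompletion L) = 1 := by
  rw [card_eq_two_iff v hKL S hS]
  constructor
  · intro hall w _
    rw [Summit.Ventures.HodgeRepro2.T5CompletionFundamentalIdentity.finrank_eq_ramificationIdx'_mul_inertiaDeg' v w]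
    exact hall w ((hS w).2 inferInstance)
  · intro hall w hw
    haveI := (hS w).1 hw
    rw [← Summit.Ventures.HodgeRepro2.T5CompletionFundamentalIdentity.finrank_eq_ramificationIdx'_mul_inertiaDeg' v w]
    exact hall w

/-- For a quadratic `L/K`: there is ONE place above `v` exactly when `e(w∣v) · f(w∣v) = 2` at some place `w` above
`v`. -/
theorem card_eq_one_iff (hKL : Module.finrank K L = 2)
    (S : Finset (HeightOneSpectrum (NumberField.RingOfIntegers L)))
    (hS : ∀ w : HeightOneSpectrum (NumberField.RingOfIntegers L), w ∈ S ↔ w.asIdeal.LiesOver v.asIdeal) :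
    S.card = 1 ↔ ∃ w ∈ S, v.asIdeal.ramificationIdx' w.asIdeal * v.asIdeal.inertiaDeg' w.asIdeal = 2 := by
  constructor
  · intro hcard
    obtain ⟨w, hw⟩ := Finset.card_eq_one.1 hcard
    have hwS : w ∈ S := by rw [hw]; exact Finset.mem_singleton_self w
    refine ⟨w, hwS, ?_⟩
    have hsum := sum_ramificationIdx'_mul_inertiaDeg' v S hS
    rw [hw, Finset.sum_singleton, hKL] at hsum
    exact hsum
  · rintro ⟨w, hw, h2⟩
    haveI := (hS w).1 hw
    have h2' : Module.finrank (v.adicCompletion K) (w.adicCompletion L) = 2 := by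
      rw [Summit.Ventures.HodgeRepro2.T5CompletionFundamentalIdentity.finrank_eq_ramificationIdx'_mul_inertiaDeg' v w]
      exact h2
    rw [Finset.card_eq_one]
    refine ⟨w, ?_⟩
    ext w'
    rw [Finset.mem_singleton]
    constructor
    · intro hw'
      exact unique_of_finrank_eq_two v hKL w h2' w' ((hS w').1 hw')
    · rintro rfl
      exact hw

/-- For a quadratic `L/K`: there is ONE place above `v` exactly when `[L_w : K_v] = 2` at some place `w` above `v`. -/
theorem card_eq_one_iff_finrank (hKL : Module.finrank K L = 2)
    (S : Finset (HeightOneSpectrum (NumberField.RingOfIntegers L)))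
    (hS : ∀ w : HeightOneSpectrum (NumberField.RingOfIntegers L), w ∈ S ↔ w.asIdeal.LiesOver v.asIdeal) :
    S.card = 1 ↔ ∃ (w : HeightOneSpectrum (NumberField.RingOfIntegers L)) (_ : w.asIdeal.LiesOver v.asIdeal),
      Module.finrank (v.adicCompletion K) (w.adicCompletion L) = 2 := by
  rw [card_eq_one_iff v hKL S hS]
  constructor
  · rintro ⟨w, hw, h2⟩
    haveI := (hS w).1 hw
    refine ⟨w, inferInstance, ?_⟩
    rw [Summit.Ventures.HodgeRepro2.T5CompletionFundamentalIdentity.finrank_eq_ramificationIdx'_mul_inertiaDeg' v w]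
    exact h2
  · rintro ⟨w, hw, h2⟩
    refine ⟨w, (hS w).2 hw, ?_⟩
    rw [← Summit.Ventures.HodgeRepro2.T5CompletionFundamentalIdentity.finrank_eq_ramificationIdx'_mul_inertiaDeg' v w]
    exact h2

end Summit.Ventures.HodgeRepro2.T5CompletionDegreeSum
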